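import Literature.ModelTheory.Zilber.EACDensityFamilies
import HarnessLib

/-!
# Mantova–Masser's density question for the ALIGNED graph surfaces
# `A_{r,q} = {x₁ = r(x₀), y₁ = q(y₀)}`: a positive answer for every `deg r ≥ 2`, `q ≠ 0`

Third file on the question of Mantova–Masser (Proc. LMS 2024 = arXiv:2303.05592, §1 p. 5
"Further remarks"): in their case (dim-pi-S-1-free) — `S ⊂ ℂ² × G²` an irreducible surface with
`dim cl π(S ∩ G²) = 1` and `cl π(S ∩ G²)` not a line of rational slope — is `S ∩ Γ_exp` Zariski
dense in `S`? (Dictionary: `MMCaseDimPiOneFree`, `UnprojectedDense` of `EACDensityQuestion`; the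
*crossed* family `S_{p,q} = {x₁ = p(x₀), y₀ = q(y₁)}` with its leading-coefficient criterion is
`EACDensityFamilies`.) Here the multiplicative curve is the graph of `q` over the exponential of
the SAME coordinate: the exponential points of `A_{r,q}` are `(z, r(z), e^{z}, q(e^{z}))` with

  `e^{r(z)} = q(e^{z})`.

## Results (all unconditional, sorry-free)

* `mmCase_alignedSurface_of_two_le`: for `deg r ≥ 2`, `q ≠ 0`, `A_{r,q}` IS in case
  (dim-pi-S-1-free) (irreducible of dimension `2` with prime ideal `ker σ`, `σ` the parametrisation
  on coordinate rings; `cl π(A ∩ G²) = {x₁ = r(x₀)}` of dimension `1`, not a line).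
* `unprojectedDensityQuestion_instance_aligned`: **for every `r` with `deg r ≥ 2` and every
  `q ≠ 0` the answer is YES**: `I(A_{r,q} ∩ Γ_exp) = I(A_{r,q})` — no condition on the
  coefficients (contrast the crossed family, where the criterion needs `Re(a_d (σ i)^d) < 0`).
* `unprojectedDensityQuestion_instance_affineFibre`: a crossed surface with an AFFINE fibre,
  `S_{p, β + γX} = {x₁ = p(x₀), y₀ = β + γ y₁}` (`γ ≠ 0`), is the aligned surface
  `A_{p, (X-β)/γ}`; hence it is decided for every `deg p ≥ 2` — in particular the two surfaces
  `{x₁ = -x₀², y₀ + y₁ = 1}` (`e^{z} + e^{-z²} = 1`) and `{x₁ = x₀³, y₀ + y₁ = 1}`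
  (`e^{z} + e^{z³} = 1`), which the leading-coefficient criterion of `EACDensityFamilies` does not
  reach, have Zariski-dense exponential points (examples at the end).

## Mechanism: degenerate escape towards `e^{z} = 0`, in two contraction steps

Fix `c₀ = log q(0)` (first for `q(0) ≠ 0`; `q = X^m q₁` reduces to `q₁(0) ≠ 0` with `r - mX`,
`unprojectedDense_alignedSurface_of_ne_zero`). Let `d = deg r ≥ 2`, `a` the leading
coefficient, `ℓ = r - a X^d`. A ROOT DIRECTION is `ω` with `a ω^d = ±2πi` and `Re ω ≤ -‖ω‖/2`;
one exists as soon as `d ≥ 2` (`exists_rootDirection`: the admissible arguments are `π/d ≤ π/2`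
apart and `[2π/3, 4π/3]` has length `2π/3`). Along it, at stage `k`:
1. (`exists_alRoot`, one complex variable) solve the POLYNOMIAL equation
   `r(z₀) = (k+1)^d (±2πi) + c₀` exactly with `z₀ = (k+1) ω e^{ζ/d}`, `‖ζ‖ ≤ 1/2`, by the
   contraction `e^{ζ} = 1 - (ℓ(z₀) - c₀)/T_k` (`exists_exp_eq_one_sub_of_small`); then
   `‖z₀‖ ≍ k`, `Re z₀ ≤ -(3/16)(k+1)‖ω‖`.
2. (`exists_expPoint_near`, two complex variables) with `T' = a z₀^d`, `z(v) = z₀ e^{v₀/(dT')}`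
   and `E(v) = r(z(v)) - r(z₀) - v₀` (`‖E‖ ≤ 1/400` on the unit polydisc: second-order Taylor
   term `≤ 1/‖T'‖` plus a Lipschitz bound for `ℓ`, both `O(1/‖z₀‖)`), solve
   `e^{v₀} = (q(e^{z(v)})/q(0)) e^{-E(v)}`, `e^{v₁} = q(e^{z(v)})/q(0)` by the fixed-point lemma
   of D'Aquino–Fornasiero–Terzo (`ExpDominant.exists_exp_eq_one_add`, `n = 2`, `ε = 1/48`; the
   corrections are small because `‖e^{z(v)}‖ ≤ e^{Re z₀ + 2/(d‖a‖)} → 0`). Comparing the two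
   equations, `v₀ + E(v) = v₁` (both sides have modulus `< 2π`), so
   `r(z(v)) = T_k + c₀ + v₁` and `e^{r(z(v))} = q(0) e^{v₁} = q(e^{z(v)})`.
The solutions `z_j` have `‖z_j‖ → ∞` linearly and `w_j = e^{z_j}` with `‖w_j‖ ≤ e^{-K_j}`, `K_j`
linear: super-polynomial decay, and the Liouville elimination of `EACDensityQuestion`
(`eq_zero_of_eval₂_eq_zero_of_superdecay`, pulled back along `x₀ ↦ z`, `x₁ ↦ r(z)`, `y₀ ↦ w`,
`y₁ ↦ q(w)`) gives `I(A ∩ Γ_exp) = I(A)` (`unprojectedDense_alignedSurface_of_seq`).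

## HONEST FRAMING

These are modest, fully proved instances of an OPEN question of Mantova–Masser; they decide the
question for two explicit polynomial families of surfaces and say nothing about the general case
(e.g. the crossed surfaces `S_{p,q}` with `deg q ≥ 2` outside the leading-coefficient criterion,
or surfaces over a line of real irrational slope, remain open here; for products `L × W` with `L`
a line see Gallinaro, arXiv:2203.13767, Thm 8.8). `deg r = 1` is not treated in this file. The
existence of infinitely many zeros of `e^{r(z)} - q(e^{z})` is classical; the content is their
Zariski density in `A_{r,q}`. This is exponential-algebraic closedness for particular free rotund
surfaces, NOT Schanuel's conjecture (EAC ⇏ SC), and EC for `(3,2)` stays open; no statement of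
Mantova–Masser is used as a hypothesis, and no internally minted statement is cited as a fact.
-/

noncomputable section

open Filter Topology MvPolynomial Complex

namespace Literature.ModelTheory.Zilber

open Literature.NumberTheory.Transcendental Literature.ModelTheory.ExponentialFields

/-! ### The surfaces `A_{r,q} = {x₁ = r(x₀), y₁ = q(y₀)}` -/

section Surface

variable (r q : Polynomial ℂ)

/-- **`A_{r,q} = {x₁ = r(x₀), y₁ = q(y₀)} ⊆ ℂ² × ℂ²`**, the *aligned* graph surface: the additive
curve is the graph of `r` over `x₀` and the multiplicative curve is the graph of `q` over `y₀`
(the exponential of the SAME coordinate). Compare `graphPolySurface p q = {x₁ = p(x₀), y₀ = q(y₁)}`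
(the *crossed* family of `EACDensityFamilies`). [folklore] -/
def alignedSurface : Set (Fin 2 ⊕ Fin 2 → ℂ) :=
  {z | z (Sum.inl 1) = r.eval (z (Sum.inl 0)) ∧ z (Sum.inr 1) = q.eval (z (Sum.inr 0))}

/-- Membership in `A_{r,q}`. [folklore] -/
theorem mem_alignedSurface_iff (z : Fin 2 ⊕ Fin 2 → ℂ) :
    z ∈ alignedSurface r q ↔
      z (Sum.inl 1) = r.eval (z (Sum.inl 0)) ∧ z (Sum.inr 1) = q.eval (z (Sum.inr 0)) :=
  Iff.rfl

/-- The parametrisation `(u, w) ↦ (u, r(u), w, q(w))`. [folklore] -/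
def alParam (u w : ℂ) : Fin 2 ⊕ Fin 2 → ℂ := Sum.elim ![u, r.eval u] ![w, q.eval w]

/-- Coordinate `x₀`. [folklore] -/
@[simp] theorem alParam_inl_zero (u w : ℂ) : alParam r q u w (Sum.inl 0) = u := rfl
/-- Coordinate `x₁`. [folklore] -/
@[simp] theorem alParam_inl_one (u w : ℂ) : alParam r q u w (Sum.inl 1) = r.eval u := rfl
/-- Coordinate `y₀`. [folklore] -/
@[simp] theorem alParam_inr_zero (u w : ℂ) : alParam r q u w (Sum.inr 0) = w := rfl
/-- Coordinate `y₁`. [folklore] -/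
@[simp] theorem alParam_inr_one (u w : ℂ) : alParam r q u w (Sum.inr 1) = q.eval w := rfl

/-- `alParam r q u w ∈ A_{r,q}`. [folklore] -/
theorem alParam_mem (u w : ℂ) : alParam r q u w ∈ alignedSurface r q := ⟨rfl, rfl⟩

/-- Every point of `A_{r,q}` is an `alParam`. [folklore] -/
theorem eq_alParam_of_mem {s : Fin 2 ⊕ Fin 2 → ℂ} (hs : s ∈ alignedSurface r q) :
    s = alParam r q (s (Sum.inl 0)) (s (Sum.inr 0)) := by
  funext i
  rcases i with i | i <;> fin_cases i
  · rfl
  · exact hs.1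
  · rfl
  · exact hs.2

/-- The exponential points of `A_{r,q}`: `(u, r(u), w, q(w))` with `e^u = w`, `e^{r(u)} = q(w)`.
[folklore] -/
theorem alParam_mem_expGraph {u w : ℂ} (hu : exp u = w) (hw : exp (r.eval u) = q.eval w) :
    alParam r q u w ∈ expGraph ℂ 2 := by
  rw [mem_expGraph_iff]
  intro i
  fin_cases i
  · simp [ExponentialRing.complex_exp_eq, hu]
  · simp [ExponentialRing.complex_exp_eq, hw]

/-- The symbolic parametrisation in `ℂ[z][w]`: `x₀ ↦ z`, `x₁ ↦ r(z)`, `y₀ ↦ w`, `y₁ ↦ q(w)`.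
[folklore] -/
def alSymb : Fin 2 ⊕ Fin 2 → Polynomial (Polynomial ℂ) :=
  Sum.elim ![Polynomial.C Polynomial.X, Polynomial.C r] ![Polynomial.X, q.map Polynomial.C]

/-- Pull-back of `F ∈ ℂ[x₀, x₁, y₀, y₁]` to `ℂ[z][w]` along `alSymb`. [folklore] -/
def alPullback (F : MvPolynomial (Fin 2 ⊕ Fin 2) ℂ) : Polynomial (Polynomial ℂ) :=
  eval₂Hom (Polynomial.C.comp Polynomial.C) (alSymb r q) F

/-- `mmEval u w` on the symbols `alSymb` gives the coordinates of `alParam r q u w`. [folklore] -/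
theorem mmEval_alSymb (u w : ℂ) : (fun i => mmEval u w (alSymb r q i)) = alParam r q u w := by
  funext i
  rcases i with i | i <;> fin_cases i <;> simp [alSymb, alParam]

/-- **The pull-back evaluates to `F` on the parametrised point.** [folklore] -/
theorem mmEval_alPullback (F : MvPolynomial (Fin 2 ⊕ Fin 2) ℂ) (u w : ℂ) :
    mmEval u w (alPullback r q F) = MvPolynomial.eval (alParam r q u w) F := by
  rw [alPullback, ← RingHom.comp_apply, MvPolynomial.comp_eval₂Hom, mmEval_comp_C, mmEval_alSymb]
  rfl

/-- **Abstract density criterion (Liouville elimination) for `A_{r,q}`.** Exponential points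
`(z_k, r(z_k), w_k, q(w_k))` (`e^{z_k} = w_k`, `e^{r(z_k)} = q(w_k)`) with `‖z_k‖ → ∞`, `w_k ≠ 0` and
`‖w_k‖ ‖z_k‖^N → 0` for every `N` force `I(A_{r,q} ∩ Γ_exp) = I(A_{r,q})`.
(new in this file) [folklore] -/
theorem unprojectedDense_alignedSurface_of_seq (z w : ℕ → ℂ)
    (hz : Tendsto (fun k => ‖z k‖) atTop atTop) (hw : ∀ k, w k ≠ 0)
    (hdec : ∀ N : ℕ, Tendsto (fun k => ‖w k‖ * ‖z k‖ ^ N) atTop (𝓝 0))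
    (hexp₁ : ∀ k, exp (z k) = w k) (hexp₂ : ∀ k, exp (r.eval (z k)) = q.eval (w k)) :
    UnprojectedDense (alignedSurface r q) := by
  refine le_antisymm ?_ (vanishingIdeal_anti_mono Set.inter_subset_left)
  intro F hF
  have hG0 : alPullback r q F = 0 := by
    refine eq_zero_of_eval₂_eq_zero_of_superdecay (alPullback r q F) z w hz hw hdec fun k => ?_
    rw [← mmEval_eq_eval₂, mmEval_alPullback, ← coe_aeval_eq_eval]
    exact (mem_vanishingIdeal_iff.mp hF) _
      ⟨alParam_mem r q _ _, alParam_mem_expGraph r q (hexp₁ k) (hexp₂ k)⟩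
  rw [mem_vanishingIdeal_iff]
  intro s hs
  have h := mmEval_alPullback r q F (s (Sum.inl 0)) (s (Sum.inr 0))
  rw [hG0, map_zero, ← eq_alParam_of_mem r q hs] at h
  simpa [coe_aeval_eq_eval] using h.symm

/-! #### Case certificate: `A_{r,q}` is an irreducible surface over the curve `x₁ = r(x₀)` -/

/-- Evaluating `p(Xᵢ)` through `aeval`. [folklore] -/
theorem aeval_polynomial_aeval_X {σ : Type*} (x : σ → ℂ) (i : σ) (p : Polynomial ℂ) :
    aeval x (Polynomial.aeval (X i : MvPolynomial σ ℂ) p) = p.eval (x i) := by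
  rw [← Polynomial.aeval_algHom_apply, aeval_X, Polynomial.coe_aeval_eq_eval]

/-- The substitution `x₀ ↦ X₀`, `x₁ ↦ r(X₀)`, `y₀ ↦ X₁`, `y₁ ↦ q(X₁)` into `ℂ[X₀, X₁]` realising
the parametrisation on coordinate rings. [folklore] -/
def alSubst : Fin 2 ⊕ Fin 2 → MvPolynomial (Fin 2) ℂ :=
  Sum.elim ![X 0, Polynomial.aeval (X 0 : MvPolynomial (Fin 2) ℂ) r]
    ![X 1, Polynomial.aeval (X 1 : MvPolynomial (Fin 2) ℂ) q]

/-- Evaluating the substituted coordinate at `(u, w)` gives the coordinate of `alParam r q u w`.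
[folklore] -/
theorem aeval_alSubst (u w : ℂ) (v : Fin 2 ⊕ Fin 2) :
    aeval (![u, w] : Fin 2 → ℂ) (alSubst r q v) = alParam r q u w v := by
  rcases v with i | i <;> fin_cases i
  · simp [alSubst]
  · simp only [alSubst, Sum.elim_inl]
    simp [eval_polynomial_aeval_X]
  · simp [alSubst]
  · simp only [alSubst, Sum.elim_inr]
    simp [eval_polynomial_aeval_X]

/-- `(σ F)(u, w) = F(θ(u, w))` for the substitution `σ` and the parametrisation `θ`. [folklore] -/
theorem aeval_aeval_alSubst (u w : ℂ) (F : MvPolynomial (Fin 2 ⊕ Fin 2) ℂ) :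
    aeval (![u, w] : Fin 2 → ℂ) (aeval (alSubst r q) F) = aeval (alParam r q u w) F := by
  have hfun : (fun v => aeval (![u, w] : Fin 2 → ℂ) (alSubst r q v)) = alParam r q u w :=
    funext (aeval_alSubst r q u w)
  rw [← AlgHom.comp_apply, comp_aeval, hfun]

/-- **`I(A_{r,q}) = ker σ`.** [folklore] -/
theorem vanishingIdeal_alignedSurface :
    vanishingIdeal ℂ (alignedSurface r q) =
      RingHom.ker (aeval (alSubst r q) :
        MvPolynomial (Fin 2 ⊕ Fin 2) ℂ →ₐ[ℂ] MvPolynomial (Fin 2) ℂ) := by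
  ext F
  rw [mem_vanishingIdeal_iff, RingHom.mem_ker]
  constructor
  · intro hF
    apply MvPolynomial.funext
    intro c
    have key := aeval_aeval_alSubst r q (c 0) (c 1) F
    have hc : (![c 0, c 1] : Fin 2 → ℂ) = c := by
      funext i; fin_cases i <;> rfl
    rw [hc] at key
    rw [map_zero]
    change aeval c (aeval (alSubst r q) F) = 0
    rw [key]
    exact hF _ (alParam_mem r q _ _)
  · intro hF s hs
    rw [eq_alParam_of_mem r q hs, ← aeval_aeval_alSubst, hF, map_zero]

/-- The substitution `σ` is surjective (`σ x₀ = X₀`, `σ y₀ = X₁`). [folklore] -/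
theorem alSubst_surjective :
    Function.Surjective (aeval (alSubst r q) :
      MvPolynomial (Fin 2 ⊕ Fin 2) ℂ →ₐ[ℂ] MvPolynomial (Fin 2) ℂ) := by
  intro G
  refine ⟨rename (![Sum.inl 0, Sum.inr 0] : Fin 2 → Fin 2 ⊕ Fin 2) G, ?_⟩
  rw [aeval_rename]
  have : (alSubst r q ∘ (![Sum.inl 0, Sum.inr 0] : Fin 2 → Fin 2 ⊕ Fin 2)) = X := by
    funext i
    fin_cases i <;> simp [alSubst]
  rw [this, aeval_X_left_apply]

/-- **`A_{r,q}` is irreducible Zariski closed**: cut out by its two equations, with prime ideal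
`ker σ`. [folklore] -/
theorem isIrreducibleClosed_alignedSurface : IsIrreducibleClosed ℂ (alignedSurface r q) := by
  refine ⟨⟨vanishingIdeal ℂ (alignedSurface r q), ?_⟩, ?_⟩
  · refine le_antisymm (zeroLocus_vanishingIdeal_le _) fun z hz => ?_
    have hmem : ∀ G ∈ vanishingIdeal ℂ (alignedSurface r q), aeval z G = 0 :=
      (mem_zeroLocus_iff.1 hz)
    have e0 : (X (Sum.inl 1) - Polynomial.aeval (X (Sum.inl 0) : MvPolynomial (Fin 2 ⊕ Fin 2) ℂ) r :
        MvPolynomial (Fin 2 ⊕ Fin 2) ℂ) ∈ vanishingIdeal ℂ (alignedSurface r q) := by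
      rw [mem_vanishingIdeal_iff]
      intro w hw
      rw [map_sub, aeval_X, aeval_polynomial_aeval_X, hw.1, sub_eq_zero]
    have e1 : (X (Sum.inr 1) - Polynomial.aeval (X (Sum.inr 0) : MvPolynomial (Fin 2 ⊕ Fin 2) ℂ) q :
        MvPolynomial (Fin 2 ⊕ Fin 2) ℂ) ∈ vanishingIdeal ℂ (alignedSurface r q) := by
      rw [mem_vanishingIdeal_iff]
      intro w hw
      rw [map_sub, aeval_X, aeval_polynomial_aeval_X, hw.2, sub_eq_zero]
    refine ⟨?_, ?_⟩
    · have h0 := hmem _ e0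
      rwa [map_sub, aeval_X, aeval_polynomial_aeval_X, sub_eq_zero] at h0
    · have h1 := hmem _ e1
      rwa [map_sub, aeval_X, aeval_polynomial_aeval_X, sub_eq_zero] at h1
  · rw [vanishingIdeal_alignedSurface]
    exact RingHom.ker_isPrime _

/-- **`dim A_{r,q} = 2`**: the coordinate ring is `ℂ[X₀, X₁]`. [folklore] -/
theorem zariskiDim_alignedSurface : zariskiDim ℂ (alignedSurface r q) = (2 : ℕ) := by
  unfold zariskiDim
  rw [vanishingIdeal_alignedSurface,
    ringKrullDim_eq_of_ringEquiv
      (Ideal.quotientKerAlgEquivOfSurjective (alSubst_surjective r q)).toRingEquiv,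
    MvPolynomial.ringKrullDim_of_isNoetherianRing, ringKrullDim_eq_zero_of_field,
    Nat.card_eq_fintype_card, Fintype.card_fin, zero_add]

variable {q}

/-- The torus part of `A_{r,q}` is non-empty (`q ≠ 0`). [folklore] -/
theorem alignedSurface_inter_torusLocus_nonempty (hq : q ≠ 0) :
    (alignedSurface r q ∩ torusLocus ℂ 2).Nonempty := by
  obtain ⟨w, hw0, hqw⟩ := exists_ne_zero_eval_ne_zero hq
  refine ⟨alParam r q 0 w, alParam_mem r q 0 w, ?_⟩
  rw [mem_torusLocus_iff]
  intro i; fin_cases i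
  · simpa using hw0
  · simpa using hqw

/-- `π(A_{r,q} ∩ G²)` is the whole curve `{x₁ = r(x₀)}` (`q ≠ 0`). [folklore] -/
theorem projAdd_image_alignedSurface_inter_torusLocus (hq : q ≠ 0) :
    projAdd '' (alignedSurface r q ∩ torusLocus ℂ 2) =
      graphBase (Polynomial.aeval (X 0 : MvPolynomial (Fin 1) ℂ) r) := by
  obtain ⟨w, hw0, hqw⟩ := exists_ne_zero_eval_ne_zero hq
  ext x
  simp only [Set.mem_image, Set.mem_inter_iff, graphBase, Set.mem_setOf_eq,
    eval_polynomial_aeval_X]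
  constructor
  · rintro ⟨z, ⟨hz, -⟩, rfl⟩
    rw [mem_alignedSurface_iff] at hz
    simpa using hz.1
  · intro hx
    refine ⟨alParam r q (x 0) w, ⟨alParam_mem r q _ _, ?_⟩, ?_⟩
    · rw [mem_torusLocus_iff]; intro i; fin_cases i
      · simpa using hw0
      · simpa using hqw
    · funext i
      fin_cases i
      · rfl
      · simpa using hx.symm

/-- `dim cl π(A_{r,q} ∩ G²) = 1` (`q ≠ 0`). [folklore] -/
theorem addProjDim_alignedSurface (hq : q ≠ 0) : addProjDim ℂ 2 (alignedSurface r q) = (1 : ℕ) := by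
  unfold addProjDim zariskiDim
  rw [projAdd_image_alignedSurface_inter_torusLocus r hq, vanishingIdeal_graphBase,
    ringKrullDim_eq_of_ringEquiv
      (Ideal.quotientKerAlgEquivOfSurjective (graphSubst_surjective _)).toRingEquiv,
    MvPolynomial.ringKrullDim_of_isNoetherianRing, ringKrullDim_eq_zero_of_field,
    Nat.card_eq_fintype_card, Fintype.card_fin, zero_add]

/-- Points of the base curve lie in the Zariski closure of `π(A_{r,q} ∩ G²)`. [folklore] -/
theorem mem_zeroLocus_projAdd_alignedSurface (hq : q ≠ 0) {x : Fin 2 → ℂ}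
    (hx : x 1 = r.eval (x 0)) :
    x ∈ zeroLocus ℂ (vanishingIdeal ℂ (projAdd '' (alignedSurface r q ∩ torusLocus ℂ 2))) := by
  rw [projAdd_image_alignedSurface_inter_torusLocus r hq, mem_zeroLocus_iff]
  intro G hG
  refine (mem_vanishingIdeal_iff.mp hG) x ?_
  simp only [graphBase, Set.mem_setOf_eq, eval_polynomial_aeval_X]
  simpa using hx

/-- If `m₀ x + m₁ r(x) ≡ c` forces `m₀ = m₁ = 0`, then `cl π(A_{r,q} ∩ G²)` is not a line of rational
slope (`q ≠ 0`). [folklore] -/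
theorem not_isRationalSlopeLine_alignedSurface (hq : q ≠ 0)
    (h : ∀ (m₀ m₁ : ℤ) (c : ℂ), (∀ x : ℂ, (m₀ : ℂ) * x + (m₁ : ℂ) * r.eval x = c) →
      m₀ = 0 ∧ m₁ = 0) :
    ¬ IsRationalSlopeLine
      (zeroLocus ℂ (vanishingIdeal ℂ (projAdd '' (alignedSurface r q ∩ torusLocus ℂ 2)))) := by
  rintro ⟨m, hm, c, hL⟩
  have hsub : ∀ x : ℂ, (m 0 : ℂ) * x + (m 1 : ℂ) * r.eval x = c := by
    intro x
    have hxZ := mem_zeroLocus_projAdd_alignedSurface r hq (x := ![x, r.eval x]) (by simp)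
    rw [hL] at hxZ
    simpa using hxZ
  obtain ⟨h0, h1⟩ := h (m 0) (m 1) c hsub
  exact hm (funext fun i => by fin_cases i <;> assumption)

/-- **Case certificate for `deg r ≥ 2`, `q ≠ 0`**: `A_{r,q}` is in Mantova–Masser's case
(dim-pi-S-1-free). [folklore] -/
theorem mmCase_alignedSurface_of_two_le (hd : 2 ≤ r.natDegree) (hq : q ≠ 0) :
    MMCaseDimPiOneFree (alignedSurface r q) :=
  ⟨isIrreducibleClosed_alignedSurface r q, alignedSurface_inter_torusLocus_nonempty r hq,
    zariskiDim_alignedSurface r q, addProjDim_alignedSurface r hq,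
    not_isRationalSlopeLine_alignedSurface r hq (coeffs_eq_zero_of_two_le_natDegree hd)⟩

end Surface

/-! ### Part 2 — analysis: the two-step construction of exponential points with `e^{z} → 0` -/

section Analysis

open Literature.Geometry.Symplectic.RotationBranch (norm_pow_sub_pow_le)

/-- `1/3 ≤ e⁻¹` (the bound `e ≤ 3` is `Literature.Computability.MetaComplexity.exp_one_le_three`
in the tree; re-derived inline from `Real.exp_one_lt_d9` to keep the import light). [folklore] -/
theorem third_le_exp_neg_one : 1 / 3 ≤ Real.exp (-1) := by
  have h3 : Real.exp 1 ≤ 3 := by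
    have := Real.exp_one_lt_d9; norm_num at this; linarith
  rw [Real.exp_neg, one_div]
  exact inv_anti₀ (Real.exp_pos 1) h3

/-- `‖e^{x}‖ ≤ 3` for `‖x‖ ≤ 1`. [folklore] -/
theorem norm_exp_le_three {x : ℂ} (hx : ‖x‖ ≤ 1) : ‖exp x‖ ≤ 3 := by
  have h3 : Real.exp 1 ≤ 3 := by
    have := Real.exp_one_lt_d9; norm_num at this; linarith
  rw [Complex.norm_exp]
  exact (Real.exp_le_exp.mpr ((re_le_norm x).trans hx)).trans h3

/-- `1/3 ≤ ‖e^{x}‖` for `‖x‖ ≤ 1`. [folklore] -/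
theorem third_le_norm_exp {x : ℂ} (hx : ‖x‖ ≤ 1) : 1 / 3 ≤ ‖exp x‖ := by
  rw [Complex.norm_exp]
  refine third_le_exp_neg_one.trans (Real.exp_le_exp.mpr ?_)
  have h1 : |x.re| ≤ ‖x‖ := Complex.abs_re_le_norm x
  have h2 := neg_abs_le x.re
  linarith

/-- `‖e^{x} - 1‖ ≤ 5/16` for `‖x‖ ≤ 1/4`. [folklore] -/
theorem norm_exp_sub_one_le_of_quarter {x : ℂ} (hx : ‖x‖ ≤ 1 / 4) : ‖exp x - 1‖ ≤ 5 / 16 := by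
  have h1 : ‖exp x - 1 - x‖ ≤ ‖x‖ ^ 2 := Complex.norm_exp_sub_one_sub_id_le (hx.trans (by norm_num))
  have h2 : ‖exp x - 1‖ ≤ ‖exp x - 1 - x‖ + ‖x‖ := by
    have := norm_add_le (exp x - 1 - x) x
    rwa [sub_add_cancel] at this
  have h3 : ‖x‖ ^ 2 ≤ (1 / 4) ^ 2 := pow_le_pow_left₀ (norm_nonneg _) hx 2
  linarith

/-- `‖ℓ(z)‖ ≤ (Σ ‖ℓᵢ‖) Mⁿ` for `‖z‖ ≤ M`, `1 ≤ M`, `deg ℓ ≤ n`. [folklore] -/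
theorem norm_eval_le_of_natDegree_le (ℓ : Polynomial ℂ) {z : ℂ} {M : ℝ} (hM : 1 ≤ M)
    (hz : ‖z‖ ≤ M) {n : ℕ} (hn : ℓ.natDegree ≤ n) : ‖ℓ.eval z‖ ≤ coeffNormSum ℓ * M ^ n := by
  have h := norm_eval_le_sum_mul_pow ℓ z
  refine h.trans (mul_le_mul_of_nonneg_left ?_ (coeffNormSum_nonneg ℓ))
  calc max 1 ‖z‖ ^ ℓ.natDegree ≤ M ^ ℓ.natDegree :=
        pow_le_pow_left₀ (by positivity) (max_le hM hz) _
    _ ≤ M ^ n := pow_le_pow_right₀ hM hn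

/-- **Lipschitz bound** `‖ℓ(z₁) - ℓ(z₂)‖ ≤ (Σ ‖ℓᵢ‖)(n+1) Mⁿ ‖z₁ - z₂‖` on the disc `‖z‖ ≤ M`
(`1 ≤ M`, `deg ℓ ≤ n + 1`). [folklore] -/
theorem norm_eval_sub_eval_le (ℓ : Polynomial ℂ) {z₁ z₂ : ℂ} {M : ℝ} (hM : 1 ≤ M)
    (h₁ : ‖z₁‖ ≤ M) (h₂ : ‖z₂‖ ≤ M) {n : ℕ} (hn : ℓ.natDegree ≤ n + 1) :
    ‖ℓ.eval z₁ - ℓ.eval z₂‖ ≤ coeffNormSum ℓ * (n + 1) * M ^ n * ‖z₁ - z₂‖ := by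
  rw [Polynomial.eval_eq_sum_range, Polynomial.eval_eq_sum_range, ← Finset.sum_sub_distrib]
  calc ‖∑ i ∈ Finset.range (ℓ.natDegree + 1), (ℓ.coeff i * z₁ ^ i - ℓ.coeff i * z₂ ^ i)‖
      ≤ ∑ i ∈ Finset.range (ℓ.natDegree + 1), ‖ℓ.coeff i * z₁ ^ i - ℓ.coeff i * z₂ ^ i‖ :=
        norm_sum_le _ _
    _ ≤ ∑ i ∈ Finset.range (ℓ.natDegree + 1), ‖ℓ.coeff i‖ * ((n + 1) * M ^ n * ‖z₁ - z₂‖) := by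
        refine Finset.sum_le_sum fun i hi => ?_
        have hi' : i ≤ n + 1 := (Nat.lt_succ_iff.mp (Finset.mem_range.mp hi)).trans hn
        rw [← mul_sub, norm_mul]
        refine mul_le_mul_of_nonneg_left ?_ (norm_nonneg _)
        calc ‖z₁ ^ i - z₂ ^ i‖ ≤ i * M ^ (i - 1) * ‖z₁ - z₂‖ := norm_pow_sub_pow_le h₁ h₂ i
          _ ≤ (n + 1) * M ^ n * ‖z₁ - z₂‖ := by
              refine mul_le_mul_of_nonneg_right ?_ (norm_nonneg _)
              refine mul_le_mul ?_ (pow_le_pow_right₀ hM (by omega)) (by positivity)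
                (by positivity)
              exact_mod_cast hi'
    _ = coeffNormSum ℓ * (n + 1) * M ^ n * ‖z₁ - z₂‖ := by
        rw [coeffNormSum, Finset.sum_mul, Finset.sum_mul, Finset.sum_mul]
        exact Finset.sum_congr rfl fun i _ => by ring

/-- `r(u) = ℓ(u) + a u^d` with `ℓ = r.eraseLead`, `a` the leading coefficient, `d = deg r`.
[folklore] -/
theorem eval_eq_eraseLead_add (r : Polynomial ℂ) (u : ℂ) :
    r.eval u = r.eraseLead.eval u + r.leadingCoeff * u ^ r.natDegree := by
  conv_lhs => rw [← Polynomial.eraseLead_add_monomial_natDegree_leadingCoeff r]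
  rw [Polynomial.eval_add, Polynomial.eval_monomial]

/-- If `e^{a} = e^{b}` and `‖a - b‖ < 2π` then `a = b`. [folklore] -/
theorem eq_of_exp_eq_exp_of_norm_sub_lt {a b : ℂ} (h : exp a = exp b) (hab : ‖a - b‖ < 2 * Real.pi) :
    a = b := by
  obtain ⟨n, hn⟩ := Complex.exp_eq_exp_iff_exists_int.mp h
  have hnorm : ‖(n : ℂ) * (2 * Real.pi * I)‖ = |(n : ℝ)| * (2 * Real.pi) := by
    rw [norm_mul, Complex.norm_intCast]
    congr 1
    simp [Complex.norm_real, Real.norm_eq_abs, abs_of_pos Real.pi_pos]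
  have hlt : |(n : ℝ)| * (2 * Real.pi) < 1 * (2 * Real.pi) := by
    rw [← hnorm, one_mul]
    have : a - b = (n : ℂ) * (2 * Real.pi * I) := by rw [hn]; ring
    rwa [← this]
  have hn0 : n = 0 := by
    have h1 : |(n : ℝ)| < 1 := lt_of_mul_lt_mul_right hlt (by positivity)
    have h2 : |n| < 1 := by exact_mod_cast h1
    exact Int.abs_lt_one_iff.mp h2
  rw [hn, hn0]; simp

/-- **Step 1 — an exact root of `r(z) = T + c₀` on the ray, by contraction.** If `a z₁^d = T ≠ 0`
and the lower-order part is small, `‖ℓ(z₁ e^{ζ/d}) - c₀‖ ≤ ‖T‖/32` for `‖ζ‖ < 1`, then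
`r(z₁ e^{ζ/d}) = T + c₀` for some `‖ζ‖ ≤ 1/2` (solve `e^{ζ} = 1 - (ℓ(z) - c₀)/T` by
`exists_exp_eq_one_sub_of_small`). (new in this file) [folklore] -/
theorem exists_polyRoot_mul_exp (r : Polynomial ℂ) (hd : 0 < r.natDegree) (z₁ T c₀ : ℂ)
    (hT : r.leadingCoeff * z₁ ^ r.natDegree = T) (hT0 : T ≠ 0)
    (hsmall : ∀ ζ : ℂ, ‖ζ‖ < 1 →
      ‖r.eraseLead.eval (z₁ * exp (ζ / r.natDegree)) - c₀‖ ≤ ‖T‖ / 32) :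
    ∃ ζ : ℂ, ‖ζ‖ ≤ 1 / 2 ∧ r.eval (z₁ * exp (ζ / r.natDegree)) = T + c₀ := by
  have hd0 : ((r.natDegree : ℕ) : ℂ) ≠ 0 := Nat.cast_ne_zero.mpr hd.ne'
  set P : ℂ → ℂ := fun ζ => (r.eraseLead.eval (z₁ * exp (ζ / r.natDegree)) - c₀) / T with hP
  have hPd : DifferentiableOn ℂ P (Metric.ball 0 1) := by
    apply Differentiable.differentiableOn
    have h1 : Differentiable ℂ fun ζ : ℂ => z₁ * exp (ζ / r.natDegree) :=
      (differentiable_const _).mul ((differentiable_id.div_const _).cexp)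
    exact (((Polynomial.differentiable _).comp h1).sub (differentiable_const _)).div_const _
  have hPb : ∀ ζ ∈ Metric.ball (0 : ℂ) 1, ‖P ζ‖ ≤ 1 / 32 := by
    intro ζ hζ
    rw [Metric.mem_ball, dist_zero_right] at hζ
    have h := hsmall ζ hζ
    show ‖(r.eraseLead.eval (z₁ * exp (ζ / r.natDegree)) - c₀) / T‖ ≤ 1 / 32
    rw [norm_div, div_le_iff₀ (norm_pos_iff.mpr hT0)]
    linarith
  obtain ⟨ζ, hζ, hexp⟩ := exists_exp_eq_one_sub_of_small 0 Complex.exp_zero P hPd hPb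
  rw [sub_zero] at hζ
  refine ⟨ζ, hζ, ?_⟩
  have hpow : (z₁ * exp (ζ / r.natDegree)) ^ r.natDegree = z₁ ^ r.natDegree * exp ζ := by
    rw [mul_pow, ← Complex.exp_nat_mul, mul_div_cancel₀ _ hd0]
  rw [eval_eq_eraseLead_add, hpow, ← mul_assoc, hT, hexp]
  show r.eraseLead.eval (z₁ * exp (ζ / r.natDegree)) +
      T * (1 - (r.eraseLead.eval (z₁ * exp (ζ / r.natDegree)) - c₀) / T) = T + c₀
  field_simp
  ring

/-- **Step 2 — from an exact root to an exponential point (two-variable contraction).**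
Let `r(z₀) = T + c₀` with `e^{T} = 1`, `e^{c₀} = q(0)`, `deg r = d ≥ 2`, leading coefficient `a`.
If `z₀` is large (`‖z₀‖ ≥ 400 (1 + 2·3^{d-2} Σ‖ℓᵢ‖)/‖a‖`, `‖a‖ ‖z₀‖ ≥ 1`) and deep in the left
half-plane (`(Σ‖qᵢ‖/‖q(0)‖) e^{Re z₀ + 2/(d‖a‖)} ≤ 1/100`, `e^{Re z₀ + 2/(d‖a‖)} ≤ 1`), then there is
`z` with `‖z - z₀‖ ≤ 2/(d‖a‖)` and **`e^{r(z)} = q(e^{z})`**. Proof: with `T' = a z₀^d`,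
`z(v) = z₀ e^{v₀/(dT')}`, `E(v) = r(z(v)) - r(z₀) - v₀` (`‖E‖ ≤ 1/400` on the unit polydisc),
solve `e^{v₀} = (q(e^{z(v)})/q(0)) e^{-E(v)}`, `e^{v₁} = q(e^{z(v)})/q(0)` by
`ExpDominant.exists_exp_eq_one_add` (`n = 2`, `ε = 1/48`); then `v₀ + E(v) = v₁`, so
`r(z(v)) = T + c₀ + v₁` and `e^{r(z(v))} = q(0) e^{v₁} = q(e^{z(v)})`. (new in this file) [folklore] -/
theorem exists_expPoint_near (r q : Polynomial ℂ) (hd : 2 ≤ r.natDegree) (hq0 : q.eval 0 ≠ 0)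
    (z₀ T c₀ : ℂ) (hroot : r.eval z₀ = T + c₀) (hT : exp T = 1) (hc₀ : exp c₀ = q.eval 0)
    (hz1 : 1 ≤ ‖z₀‖) (haz : 1 ≤ ‖r.leadingCoeff‖ * ‖z₀‖)
    (hE : 400 * ((1 + 2 * 3 ^ (r.natDegree - 2) * coeffNormSum r.eraseLead) / ‖r.leadingCoeff‖)
      ≤ ‖z₀‖)
    (hρ : coeffNormSum q / ‖q.eval 0‖ *
      Real.exp (z₀.re + 2 / (r.natDegree * ‖r.leadingCoeff‖)) ≤ 1 / 100)
    (hρ1 : Real.exp (z₀.re + 2 / (r.natDegree * ‖r.leadingCoeff‖)) ≤ 1) :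
    ∃ z : ℂ, exp (r.eval z) = q.eval (exp z) ∧
      ‖z - z₀‖ ≤ 2 / (r.natDegree * ‖r.leadingCoeff‖) := by
  -- notation
  set d : ℕ := r.natDegree with hd_def
  set a : ℂ := r.leadingCoeff with ha_def
  set ℓ : Polynomial ℂ := r.eraseLead with hℓ_def
  set R : ℝ := ‖z₀‖ with hR_def
  set q₀ : ℂ := q.eval 0 with hq₀_def
  have hd1 : 1 ≤ d := le_trans (by norm_num) hd
  have hdR : (1 : ℝ) ≤ d := by exact_mod_cast hd1
  have hdC : (d : ℂ) ≠ 0 := Nat.cast_ne_zero.mpr (by omega)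
  have ha_pos : 0 < ‖a‖ := by
    rcases (norm_nonneg a).eq_or_lt with h | h
    · rw [← h, zero_mul] at haz; linarith
    · exact h
  have ha0 : a ≠ 0 := norm_pos_iff.mp ha_pos
  have hR1 : 1 ≤ R := hz1
  have hR0 : 0 < R := by linarith
  have hz0 : z₀ ≠ 0 := norm_pos_iff.mp hR0
  set T' : ℂ := a * z₀ ^ d with hT'_def
  have hT'norm : ‖T'‖ = ‖a‖ * R ^ d := by rw [hT'_def, norm_mul, norm_pow]
  have hRd : R ≤ R ^ d := le_self_pow₀ hR1 (by omega)
  have hT'1 : 1 ≤ ‖T'‖ := by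
    rw [hT'norm]
    exact haz.trans (mul_le_mul_of_nonneg_left hRd ha_pos.le)
  have hT'pos : 0 < ‖T'‖ := by linarith
  have hT'0 : T' ≠ 0 := norm_pos_iff.mp hT'pos
  set δ : ℝ := 2 / (d * ‖a‖) with hδ_def
  have hδ_pos : 0 < δ := by positivity
  -- the maps
  set xx : (Fin 2 → ℂ) → ℂ := fun v => v 0 / (d * T') with hxx
  set zz : (Fin 2 → ℂ) → ℂ := fun v => z₀ * exp (xx v) with hzz
  set E : (Fin 2 → ℂ) → ℂ := fun v => r.eval (zz v) - r.eval z₀ - v 0 with hE_def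
  set g₁ : (Fin 2 → ℂ) → ℂ := fun v => q.eval (exp (zz v)) / q₀ - 1 with hg₁
  set g₀ : (Fin 2 → ℂ) → ℂ := fun v => (1 + g₁ v) * exp (-E v) - 1 with hg₀
  -- differentiability
  have hxx_d : Differentiable ℂ xx := by
    show Differentiable ℂ (fun v : Fin 2 → ℂ => v 0 / ((d : ℂ) * T'))
    simp_rw [div_eq_mul_inv]
    exact (differentiable_apply (𝕜 := ℂ) (0 : Fin 2)).mul_const _
  have hzz_d : Differentiable ℂ zz := (differentiable_const z₀).mul hxx_d.cexp
  have hE_d : Differentiable ℂ E :=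
    (((Polynomial.differentiable r).comp hzz_d).sub (differentiable_const _)).sub
      (differentiable_apply 0)
  have hg₁_d : Differentiable ℂ g₁ := by
    show Differentiable ℂ (fun v => q.eval (exp (zz v)) / q₀ - 1)
    simp_rw [div_eq_mul_inv]
    exact (((Polynomial.differentiable q).comp hzz_d.cexp).mul_const _).sub
      (differentiable_const _)
  have hg₀_d : Differentiable ℂ g₀ :=
    (((differentiable_const _).add hg₁_d).mul hE_d.neg.cexp).sub (differentiable_const _)
  -- estimates for `‖v 0‖ ≤ 1`
  have hxx_le : ∀ v : Fin 2 → ℂ, ‖v 0‖ ≤ 1 → ‖xx v‖ ≤ ‖v 0‖ / (d * ‖T'‖) := by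
    intro v hv
    show ‖v 0 / (d * T')‖ ≤ ‖v 0‖ / (d * ‖T'‖)
    rw [norm_div, norm_mul, Complex.norm_natCast]
  have hxx_one : ∀ v : Fin 2 → ℂ, ‖v 0‖ ≤ 1 → ‖xx v‖ ≤ 1 := by
    intro v hv
    refine (hxx_le v hv).trans ?_
    rw [div_le_one (by positivity)]
    nlinarith
  have hdiff : ∀ v : Fin 2 → ℂ, ‖v 0‖ ≤ 1 → ‖zz v - z₀‖ ≤ 2 * R / (d * ‖T'‖) := by
    intro v hv
    have h1 : zz v - z₀ = z₀ * (exp (xx v) - 1) := by simp only [hzz]; ring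
    rw [h1, norm_mul]
    calc ‖z₀‖ * ‖exp (xx v) - 1‖ ≤ R * (2 * ‖xx v‖) :=
          mul_le_mul_of_nonneg_left (Complex.norm_exp_sub_one_le (hxx_one v hv)) (norm_nonneg _)
      _ ≤ R * (2 * (1 / (d * ‖T'‖))) := by
          refine mul_le_mul_of_nonneg_left (mul_le_mul_of_nonneg_left ?_ (by norm_num)) hR0.le
          exact (hxx_le v hv).trans (div_le_div_of_nonneg_right hv (by positivity))
      _ = 2 * R / (d * ‖T'‖) := by ring
  have hRT : 2 * R / (d * ‖T'‖) ≤ δ := by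
    rw [hδ_def, hT'norm, div_le_div_iff₀ (by positivity) (by positivity)]
    have : R * ‖a‖ ≤ ‖a‖ * R ^ d := by rw [mul_comm]; exact mul_le_mul_of_nonneg_left hRd ha_pos.le
    nlinarith [this, hdR]
  have hdiffδ : ∀ v : Fin 2 → ℂ, ‖v 0‖ ≤ 1 → ‖zz v - z₀‖ ≤ δ := fun v hv => (hdiff v hv).trans hRT
  have hzz3 : ∀ v : Fin 2 → ℂ, ‖v 0‖ ≤ 1 → ‖zz v‖ ≤ 3 * R := by
    intro v hv
    show ‖z₀ * exp (xx v)‖ ≤ 3 * R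
    rw [norm_mul, mul_comm]
    exact mul_le_mul_of_nonneg_right (norm_exp_le_three (hxx_one v hv)) (norm_nonneg _)
  have hre : ∀ v : Fin 2 → ℂ, ‖v 0‖ ≤ 1 → (zz v).re ≤ z₀.re + δ := by
    intro v hv
    have h1 : (zz v).re = z₀.re + (zz v - z₀).re := by simp
    rw [h1]
    exact add_le_add le_rfl ((re_le_norm _).trans (hdiffδ v hv))
  -- the remainder `E`
  have hE_eq : ∀ v : Fin 2 → ℂ, E v = T' * (exp (v 0 / T') - 1 - v 0 / T') +
      (ℓ.eval (zz v) - ℓ.eval z₀) := by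
    intro v
    have hpow : (zz v) ^ d = z₀ ^ d * exp (v 0 / T') := by
      show (z₀ * exp (v 0 / (d * T'))) ^ d = z₀ ^ d * exp (v 0 / T')
      rw [mul_pow, ← Complex.exp_nat_mul]
      congr 2
      field_simp
    show r.eval (zz v) - r.eval z₀ - v 0 = _
    rw [eval_eq_eraseLead_add r (zz v), eval_eq_eraseLead_add r z₀, hpow]
    have : T' * (v 0 / T') = v 0 := mul_div_cancel₀ _ hT'0
    rw [← ha_def, ← hℓ_def, ← hd_def]
    linear_combination this
  have hEle : ∀ v : Fin 2 → ℂ, ‖v 0‖ ≤ 1 → ‖E v‖ ≤ 1 / 400 := by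
    intro v hv
    have hy : ‖v 0 / T'‖ ≤ 1 := by
      rw [norm_div, div_le_one hT'pos]; exact hv.trans hT'1
    have h1 : ‖T' * (exp (v 0 / T') - 1 - v 0 / T')‖ ≤ 1 / (‖a‖ * R) := by
      rw [norm_mul]
      calc ‖T'‖ * ‖exp (v 0 / T') - 1 - v 0 / T'‖ ≤ ‖T'‖ * ‖v 0 / T'‖ ^ 2 :=
            mul_le_mul_of_nonneg_left (Complex.norm_exp_sub_one_sub_id_le hy) (norm_nonneg _)
        _ = ‖v 0‖ ^ 2 / ‖T'‖ := by rw [norm_div]; field_simp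
        _ ≤ 1 / ‖T'‖ := by
            refine div_le_div_of_nonneg_right ?_ hT'pos.le
            nlinarith [norm_nonneg (v 0)]
        _ ≤ 1 / (‖a‖ * R) := by
            rw [hT'norm]
            exact one_div_le_one_div_of_le (by positivity) (mul_le_mul_of_nonneg_left hRd ha_pos.le)
    have hM : (1 : ℝ) ≤ 3 * R := by linarith
    have hℓdeg : ℓ.natDegree ≤ (d - 2) + 1 := by
      have := Polynomial.eraseLead_natDegree_le r
      rw [← hℓ_def, ← hd_def] at this
      omega
    have h2 : ‖ℓ.eval (zz v) - ℓ.eval z₀‖ ≤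
        coeffNormSum ℓ * ((d - 2 : ℕ) + 1) * (3 * R) ^ (d - 2) * ‖zz v - z₀‖ :=
      norm_eval_sub_eval_le ℓ hM (hzz3 v hv) (by linarith) hℓdeg
    have h3 : coeffNormSum ℓ * ((d - 2 : ℕ) + 1) * (3 * R) ^ (d - 2) * ‖zz v - z₀‖ ≤
        2 * 3 ^ (d - 2) * coeffNormSum ℓ / (‖a‖ * R) := by
      have hcast : ((d - 2 : ℕ) : ℝ) + 1 ≤ d := by
        rw [Nat.cast_sub hd]; push_cast; linarith
      have hRpow : R ^ d = R ^ (d - 2) * R * R := by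
        rw [← pow_succ, ← pow_succ]; congr 1; omega
      calc coeffNormSum ℓ * ((d - 2 : ℕ) + 1) * (3 * R) ^ (d - 2) * ‖zz v - z₀‖
          ≤ coeffNormSum ℓ * d * (3 * R) ^ (d - 2) * (2 * R / (d * ‖T'‖)) := by
            refine mul_le_mul ?_ (hdiff v hv) (norm_nonneg _)
              (by have := coeffNormSum_nonneg ℓ; positivity)
            refine mul_le_mul_of_nonneg_right ?_ (by positivity)
            exact mul_le_mul_of_nonneg_left hcast (coeffNormSum_nonneg ℓ)
        _ = 2 * 3 ^ (d - 2) * coeffNormSum ℓ / (‖a‖ * R) := by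
            rw [hT'norm, hRpow, mul_pow]
            field_simp
    calc ‖E v‖ ≤ ‖T' * (exp (v 0 / T') - 1 - v 0 / T')‖ + ‖ℓ.eval (zz v) - ℓ.eval z₀‖ := by
          rw [hE_eq]; exact norm_add_le _ _
      _ ≤ 1 / (‖a‖ * R) + 2 * 3 ^ (d - 2) * coeffNormSum ℓ / (‖a‖ * R) :=
          add_le_add h1 (h2.trans h3)
      _ = (1 + 2 * 3 ^ (d - 2) * coeffNormSum ℓ) / ‖a‖ / R := by
          field_simp
      _ ≤ 1 / 400 := by
          rw [div_le_iff₀ hR0]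
          linarith
  -- the two correction terms are small on the unit polydisc
  have hexpzz : ∀ v : Fin 2 → ℂ, ‖v 0‖ ≤ 1 → ‖exp (zz v)‖ ≤ Real.exp (z₀.re + δ) := by
    intro v hv
    rw [Complex.norm_exp]
    exact Real.exp_le_exp.mpr (hre v hv)
  have hg₁le : ∀ v : Fin 2 → ℂ, ‖v 0‖ ≤ 1 → ‖g₁ v‖ ≤ 1 / 100 := by
    intro v hv
    have hw1 : ‖exp (zz v)‖ ≤ 1 := (hexpzz v hv).trans hρ1
    have h1 : g₁ v = (q.eval (exp (zz v)) - q₀) / q₀ := by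
      simp only [hg₁]; field_simp
    rw [h1, norm_div]
    calc ‖q.eval (exp (zz v)) - q₀‖ / ‖q₀‖
        ≤ coeffNormSum q * ‖exp (zz v)‖ / ‖q₀‖ :=
          div_le_div_of_nonneg_right (norm_eval_sub_eval_zero_le q hw1) (norm_nonneg _)
      _ ≤ coeffNormSum q * Real.exp (z₀.re + δ) / ‖q₀‖ :=
          div_le_div_of_nonneg_right
            (mul_le_mul_of_nonneg_left (hexpzz v hv) (coeffNormSum_nonneg q)) (norm_nonneg _)
      _ = coeffNormSum q / ‖q₀‖ * Real.exp (z₀.re + δ) := by ring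
      _ ≤ 1 / 100 := hρ
  have hg₀le : ∀ v : Fin 2 → ℂ, ‖v 0‖ ≤ 1 → ‖g₀ v‖ ≤ 1 / 48 := by
    intro v hv
    have h1 : g₀ v = (1 + g₁ v) * (exp (-E v) - 1) + g₁ v := by simp only [hg₀]; ring
    have hE1 : ‖-E v‖ ≤ 1 := by rw [norm_neg]; exact (hEle v hv).trans (by norm_num)
    have h2 : ‖exp (-E v) - 1‖ ≤ 2 * ‖E v‖ := by
      have := Complex.norm_exp_sub_one_le hE1; rwa [norm_neg] at this
    rw [h1]
    calc ‖(1 + g₁ v) * (exp (-E v) - 1) + g₁ v‖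
        ≤ ‖1 + g₁ v‖ * ‖exp (-E v) - 1‖ + ‖g₁ v‖ := by
          rw [← norm_mul]; exact norm_add_le _ _
      _ ≤ (1 + 1 / 100) * (2 * (1 / 400)) + 1 / 100 := by
          have hg := hg₁le v hv
          have hE' := hEle v hv
          have h3 : ‖1 + g₁ v‖ ≤ 1 + 1 / 100 :=
            (norm_add_le _ _).trans (by rw [norm_one]; linarith)
          have h4 : ‖exp (-E v) - 1‖ ≤ 2 * (1 / 400) := h2.trans (by linarith)
          exact add_le_add (mul_le_mul h3 h4 (norm_nonneg _) (by norm_num)) hg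
      _ ≤ 1 / 48 := by norm_num
  -- apply the two-variable contraction
  have hball : ∀ v ∈ Metric.ball (0 : Fin 2 → ℂ) 1, ‖v 0‖ ≤ 1 := by
    intro v hv
    rw [Metric.mem_ball, dist_zero_right] at hv
    exact ((norm_le_pi_norm v 0).trans hv.le)
  obtain ⟨ξ, hξ, hsol⟩ := ExpDominant.exists_exp_eq_one_add (n := 2) (ε := 1 / 48) ![g₀, g₁]
    (by norm_num) (by norm_num)
    (by
      intro j; fin_cases j
      · exact hg₀_d.differentiableOn
      · exact hg₁_d.differentiableOn)
    (by
      intro j v hv; fin_cases j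
      · exact hg₀le v (hball v hv)
      · exact (hg₁le v (hball v hv)).trans (by norm_num))
  have hξ0 : ‖ξ 0‖ ≤ 1 := (norm_le_pi_norm ξ 0).trans (hξ.trans (by norm_num))
  have h0 : exp (ξ 0) = (1 + g₁ ξ) * exp (-E ξ) := by
    have := hsol 0
    simp only [Matrix.cons_val_zero] at this
    rw [this]
    show 1 + ((1 + g₁ ξ) * exp (-E ξ) - 1) = _
    ring
  have h1 : exp (ξ 1) = 1 + g₁ ξ := by
    have := hsol 1
    simpa using this
  -- `ξ 0 + E ξ = ξ 1`
  have hlin : ξ 0 = ξ 1 - E ξ := by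
    refine eq_of_exp_eq_exp_of_norm_sub_lt ?_ ?_
    · rw [h0, ← h1, sub_eq_add_neg, Complex.exp_add]
    · have hb : ‖ξ 0 - (ξ 1 - E ξ)‖ ≤ ‖ξ 0‖ + ‖ξ 1‖ + ‖E ξ‖ := by
        calc ‖ξ 0 - (ξ 1 - E ξ)‖ = ‖(ξ 0 - ξ 1) + E ξ‖ := by ring_nf
          _ ≤ ‖ξ 0 - ξ 1‖ + ‖E ξ‖ := norm_add_le _ _
          _ ≤ ‖ξ 0‖ + ‖ξ 1‖ + ‖E ξ‖ := add_le_add (norm_sub_le _ _) le_rfl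
      have hξ1 : ‖ξ 1‖ ≤ 1 / 2 := (norm_le_pi_norm ξ 1).trans hξ
      have hξ0' : ‖ξ 0‖ ≤ 1 / 2 := (norm_le_pi_norm ξ 0).trans hξ
      have hE' := hEle ξ hξ0
      have hπ := Real.pi_gt_three
      linarith
  refine ⟨zz ξ, ?_, hdiffδ ξ hξ0⟩
  have hr : r.eval (zz ξ) = T + c₀ + ξ 1 := by
    have : E ξ = r.eval (zz ξ) - r.eval z₀ - ξ 0 := rfl
    rw [hlin] at this
    linear_combination hroot - this
  rw [hr, Complex.exp_add, Complex.exp_add, hT, hc₀, h1, one_mul, hg₁]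
  field_simp
  ring

end Analysis

/-! ### Part 3 — the escape sequence along a root direction `ω` (`a ω^d = ±2πi`, `Re ω ≤ -‖ω‖/2`) -/

section Supply

/-- `((k+1) u).re = (k+1) u.re`. [folklore] -/
theorem re_natCast_add_one_mul (k : ℕ) (u : ℂ) : (((k : ℂ) + 1) * u).re = ((k : ℝ) + 1) * u.re := by
  simp [Complex.mul_re]

/-- `‖(k : ℂ) + 1‖ = k + 1`. [folklore] -/
theorem norm_natCast_add_one (k : ℕ) : ‖((k : ℂ) + 1)‖ = (k : ℝ) + 1 := by
  have : ((k : ℂ) + 1) = (((k : ℝ) + 1 : ℝ) : ℂ) := by push_cast; ring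
  rw [this, Complex.norm_real, Real.norm_eq_abs, abs_of_pos (by positivity)]

/-- **Stage `k` of the construction: an exact root `z₀` of `r(z₀) = (k+1)^d s · 2πi + c₀` near
`(k+1) ω`**, with `(k+1)‖ω‖/3 ≤ ‖z₀‖ ≤ 3 (k+1)‖ω‖` and `Re z₀ ≤ -(3/16)(k+1)‖ω‖`, as soon as
`32 (Σ‖ℓᵢ‖ (3‖ω‖+1)^{d-1} + ‖c₀‖) ≤ 2π (k+1)` (`a ω^d = 2πi s`, `s = ±1`, `Re ω ≤ -‖ω‖/2`,
`d ≥ 2`). (new in this file) [folklore] -/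
theorem exists_alRoot (r : Polynomial ℂ) (hd : 2 ≤ r.natDegree) (ω : ℂ) (s : ℤ)
    (hs : s = 1 ∨ s = -1) (hω : r.leadingCoeff * ω ^ r.natDegree = 2 * Real.pi * I * s)
    (hre : ω.re ≤ -(‖ω‖ / 2)) (c₀ : ℂ) (k : ℕ)
    (hk : 32 * (coeffNormSum r.eraseLead * (3 * ‖ω‖ + 1) ^ (r.natDegree - 1) + ‖c₀‖) ≤
      2 * Real.pi * ((k : ℝ) + 1)) :
    ∃ z₀ : ℂ, r.eval z₀ = (((k + 1) ^ r.natDegree * s : ℤ) : ℂ) * (2 * Real.pi * I) + c₀ ∧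
      ‖z₀‖ ≤ 3 * (((k : ℝ) + 1) * ‖ω‖) ∧ ((k : ℝ) + 1) * ‖ω‖ / 3 ≤ ‖z₀‖ ∧
      z₀.re ≤ -(3 / 16) * (((k : ℝ) + 1) * ‖ω‖) := by
  set d : ℕ := r.natDegree with hd_def
  set a : ℂ := r.leadingCoeff with ha_def
  set ℓ : Polynomial ℂ := r.eraseLead with hℓ_def
  have hd1 : 1 ≤ d := le_trans (by norm_num) hd
  have hdpos : (0 : ℝ) < d := by exact_mod_cast (show 0 < d by omega)
  have hsn : ‖(s : ℂ)‖ = 1 := by rcases hs with rfl | rfl <;> simp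
  set z₁ : ℂ := ((k : ℂ) + 1) * ω with hz₁
  set T : ℂ := (((k + 1) ^ d * s : ℤ) : ℂ) * (2 * Real.pi * I) with hT_def
  have hT : a * z₁ ^ d = T := by
    have : a * z₁ ^ d = ((k : ℂ) + 1) ^ d * (a * ω ^ d) := by rw [hz₁, mul_pow]; ring
    rw [this, hω, hT_def]; push_cast; ring
  have hTnorm : ‖T‖ = 2 * Real.pi * ((k : ℝ) + 1) ^ d := by
    rw [← hT, norm_mul, norm_pow, hz₁, norm_mul, norm_natCast_add_one, mul_pow]
    have hsabs : |(s : ℝ)| = 1 := by rcases hs with rfl | rfl <;> simp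
    have haω : ‖a‖ * ‖ω‖ ^ d = 2 * Real.pi := by
      rw [← norm_pow, ← norm_mul, hω]
      simp [hsabs, Complex.norm_real, Real.norm_eq_abs, abs_of_pos Real.pi_pos]
    calc ‖a‖ * (((k : ℝ) + 1) ^ d * ‖ω‖ ^ d) = (‖a‖ * ‖ω‖ ^ d) * ((k : ℝ) + 1) ^ d := by ring
      _ = 2 * Real.pi * ((k : ℝ) + 1) ^ d := by rw [haω]
  have hTpos : 0 < ‖T‖ := by rw [hTnorm]; positivity
  have hT0 : T ≠ 0 := norm_pos_iff.mp hTpos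
  -- smallness of the lower-order part on the disc
  have hsmall : ∀ ζ : ℂ, ‖ζ‖ < 1 → ‖ℓ.eval (z₁ * exp (ζ / d)) - c₀‖ ≤ ‖T‖ / 32 := by
    intro ζ hζ
    have hx : ‖ζ / (d : ℂ)‖ ≤ 1 := by
      rw [norm_div, Complex.norm_natCast]
      exact (div_le_self (norm_nonneg _) (by exact_mod_cast hd1)).trans hζ.le
    set M : ℝ := ((k : ℝ) + 1) * (3 * ‖ω‖ + 1) with hM
    have hM1 : 1 ≤ M := by
      have h1 : (1 : ℝ) ≤ (k : ℝ) + 1 := by linarith [(Nat.cast_nonneg k : (0 : ℝ) ≤ k)]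
      have h2 : (1 : ℝ) ≤ 3 * ‖ω‖ + 1 := by linarith [norm_nonneg ω]
      nlinarith
    have hzM : ‖z₁ * exp (ζ / d)‖ ≤ M := by
      rw [norm_mul, hz₁, norm_mul, norm_natCast_add_one, hM]
      have := norm_exp_le_three hx
      have hk0 : (0 : ℝ) ≤ (k : ℝ) + 1 := by positivity
      calc ((k : ℝ) + 1) * ‖ω‖ * ‖exp (ζ / d)‖ ≤ ((k : ℝ) + 1) * ‖ω‖ * 3 := by
            exact mul_le_mul_of_nonneg_left this (by positivity)
        _ ≤ ((k : ℝ) + 1) * (3 * ‖ω‖ + 1) := by nlinarith [norm_nonneg ω]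
    have hℓdeg : ℓ.natDegree ≤ d - 1 := Polynomial.eraseLead_natDegree_le r
    have h1 : ‖ℓ.eval (z₁ * exp (ζ / d))‖ ≤ coeffNormSum ℓ * M ^ (d - 1) :=
      norm_eval_le_of_natDegree_le ℓ hM1 hzM hℓdeg
    have hkpow : (1 : ℝ) ≤ ((k : ℝ) + 1) ^ (d - 1) := one_le_pow₀ (by linarith [(Nat.cast_nonneg k : (0 : ℝ) ≤ k)])
    have h2 : ‖ℓ.eval (z₁ * exp (ζ / d)) - c₀‖ ≤
        (coeffNormSum ℓ * (3 * ‖ω‖ + 1) ^ (d - 1) + ‖c₀‖) * ((k : ℝ) + 1) ^ (d - 1) := by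
      calc ‖ℓ.eval (z₁ * exp (ζ / d)) - c₀‖ ≤ ‖ℓ.eval (z₁ * exp (ζ / d))‖ + ‖c₀‖ := norm_sub_le _ _
        _ ≤ coeffNormSum ℓ * M ^ (d - 1) + ‖c₀‖ * ((k : ℝ) + 1) ^ (d - 1) := by
            refine add_le_add h1 ?_
            exact le_mul_of_one_le_right (norm_nonneg _) hkpow
        _ = (coeffNormSum ℓ * (3 * ‖ω‖ + 1) ^ (d - 1) + ‖c₀‖) * ((k : ℝ) + 1) ^ (d - 1) := by
            rw [hM, mul_pow]; ring
    have h3 : (coeffNormSum ℓ * (3 * ‖ω‖ + 1) ^ (d - 1) + ‖c₀‖) * ((k : ℝ) + 1) ^ (d - 1) ≤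
        ‖T‖ / 32 := by
      rw [hTnorm, le_div_iff₀ (by norm_num : (0 : ℝ) < 32)]
      have hpow : ((k : ℝ) + 1) ^ d = ((k : ℝ) + 1) * ((k : ℝ) + 1) ^ (d - 1) := by
        rw [← pow_succ', Nat.sub_add_cancel hd1]
      rw [hpow]
      have h0 : (0 : ℝ) ≤ ((k : ℝ) + 1) ^ (d - 1) := by positivity
      nlinarith
    exact h2.trans h3
  obtain ⟨ζ, hζ, hroot⟩ := exists_polyRoot_mul_exp r (by omega) z₁ T c₀ hT hT0 hsmall
  -- the root and its position
  set x : ℂ := ζ / (d : ℂ) with hx_def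
  have hx4 : ‖x‖ ≤ 1 / 4 := by
    rw [hx_def, norm_div, Complex.norm_natCast]
    have hd2 : (2 : ℝ) ≤ d := by exact_mod_cast hd
    calc ‖ζ‖ / (d : ℝ) ≤ (1 / 2) / 2 := div_le_div₀ (by norm_num) hζ (by norm_num) hd2
      _ = 1 / 4 := by norm_num
  have hx1 : ‖x‖ ≤ 1 := hx4.trans (by norm_num)
  refine ⟨z₁ * exp x, hroot, ?_, ?_, ?_⟩
  · rw [norm_mul, hz₁, norm_mul, norm_natCast_add_one]
    calc ((k : ℝ) + 1) * ‖ω‖ * ‖exp x‖ ≤ ((k : ℝ) + 1) * ‖ω‖ * 3 :=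
          mul_le_mul_of_nonneg_left (norm_exp_le_three hx1) (by positivity)
      _ = 3 * (((k : ℝ) + 1) * ‖ω‖) := by ring
  · rw [norm_mul, hz₁, norm_mul, norm_natCast_add_one]
    calc ((k : ℝ) + 1) * ‖ω‖ / 3 = ((k : ℝ) + 1) * ‖ω‖ * (1 / 3) := by ring
      _ ≤ ((k : ℝ) + 1) * ‖ω‖ * ‖exp x‖ :=
          mul_le_mul_of_nonneg_left (third_le_norm_exp hx1) (by positivity)
  · have h1 : z₁ * exp x = ((k : ℂ) + 1) * (ω * exp x) := by rw [hz₁]; ring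
    rw [h1, re_natCast_add_one_mul]
    have h2 : (ω * exp x).re ≤ ω.re + ‖ω‖ * (5 / 16) := by
      have h3 : ω * exp x = ω + ω * (exp x - 1) := by ring
      rw [h3, Complex.add_re]
      refine add_le_add le_rfl ((re_le_norm _).trans ?_)
      rw [norm_mul]
      exact mul_le_mul_of_nonneg_left (norm_exp_sub_one_le_of_quarter hx4) (norm_nonneg _)
    have hk0 : (0 : ℝ) ≤ (k : ℝ) + 1 := by positivity
    calc ((k : ℝ) + 1) * (ω * exp x).re ≤ ((k : ℝ) + 1) * (ω.re + ‖ω‖ * (5 / 16)) :=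
          mul_le_mul_of_nonneg_left h2 hk0
      _ ≤ ((k : ℝ) + 1) * (-(‖ω‖ / 2) + ‖ω‖ * (5 / 16)) := by
          refine mul_le_mul_of_nonneg_left (add_le_add hre le_rfl) hk0
      _ = -(3 / 16) * (((k : ℝ) + 1) * ‖ω‖) := by ring

/-- **The escape sequence for `A_{r,q}`** (`deg r = d ≥ 2`, `q(0) ≠ 0`, a root direction `ω`
with `a ω^d = 2πi s`, `s = ±1`, `Re ω ≤ -‖ω‖/2`): exponential solutions `e^{r(z_j)} = q(e^{z_j})`
with `‖z_j‖ → ∞` and `w_j = e^{z_j}` decaying super-polynomially against `‖z_j‖`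
(stage `k = j + K₀`: `exists_alRoot`, then `exists_expPoint_near`). (new in this file) [folklore] -/
theorem exists_alignedSeq (r q : Polynomial ℂ) (hd : 2 ≤ r.natDegree) (hq0 : q.eval 0 ≠ 0)
    (ω : ℂ) (s : ℤ) (hs : s = 1 ∨ s = -1)
    (hω : r.leadingCoeff * ω ^ r.natDegree = 2 * Real.pi * I * s) (hre : ω.re ≤ -(‖ω‖ / 2)) :
    ∃ z w : ℕ → ℂ, Tendsto (fun j => ‖z j‖) atTop atTop ∧ (∀ j, w j ≠ 0) ∧
      (∀ N : ℕ, Tendsto (fun j => ‖w j‖ * ‖z j‖ ^ N) atTop (𝓝 0)) ∧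
      (∀ j, exp (z j) = w j) ∧ ∀ j, exp (r.eval (z j)) = q.eval (w j) := by
  set d : ℕ := r.natDegree with hd_def
  set a : ℂ := r.leadingCoeff with ha_def
  set ℓ : Polynomial ℂ := r.eraseLead with hℓ_def
  set c₀ : ℂ := log (q.eval 0) with hc₀_def
  have hc₀ : exp c₀ = q.eval 0 := exp_log hq0
  have hd1 : 1 ≤ d := le_trans (by norm_num) hd
  have hrhs : (2 * Real.pi * I * s : ℂ) ≠ 0 := by
    have hsC : (s : ℂ) ≠ 0 := by rcases hs with rfl | rfl <;> simp
    have hπ : (Real.pi : ℂ) ≠ 0 := Complex.ofReal_ne_zero.mpr Real.pi_pos.ne'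
    simp [hsC, hπ, Complex.I_ne_zero]
  have hω0 : ω ≠ 0 := by
    rintro rfl
    rw [zero_pow (by omega), mul_zero] at hω
    exact hrhs hω.symm
  have ha0 : a ≠ 0 := by
    intro h
    rw [h, zero_mul] at hω
    exact hrhs hω.symm
  have hωpos : 0 < ‖ω‖ := norm_pos_iff.mpr hω0
  have hapos : 0 < ‖a‖ := norm_pos_iff.mpr ha0
  -- constants
  set C₁ : ℝ := coeffNormSum ℓ * (3 * ‖ω‖ + 1) ^ (d - 1) + ‖c₀‖ with hC₁
  set C₂ : ℝ := 400 * ((1 + 2 * 3 ^ (d - 2) * coeffNormSum ℓ) / ‖a‖) with hC₂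
  set δ : ℝ := 2 / (d * ‖a‖) with hδ
  set B : ℝ := coeffNormSum q / ‖q.eval 0‖ with hB
  have hδ0 : 0 ≤ δ := by positivity
  set L : ℕ → ℝ := fun k => ((k : ℝ) + 1) * ‖ω‖ with hL_def
  have hL : Tendsto L atTop atTop := (tendsto_natCast_add_atTop 1).atTop_mul_const hωpos
  -- eventual conditions
  have hev₁ : ∀ᶠ k : ℕ in atTop, 32 * C₁ ≤ 2 * Real.pi * ((k : ℝ) + 1) :=
    ((tendsto_natCast_add_atTop 1).const_mul_atTop (by positivity : (0 : ℝ) < 2 * Real.pi)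
      ).eventually_ge_atTop _
  have hev₂ : ∀ᶠ k : ℕ in atTop, 3 ≤ L k := hL.eventually_ge_atTop 3
  have hev₃ : ∀ᶠ k : ℕ in atTop, 3 ≤ ‖a‖ * L k := (hL.const_mul_atTop hapos).eventually_ge_atTop 3
  have hev₄ : ∀ᶠ k : ℕ in atTop, 3 * C₂ ≤ L k := hL.eventually_ge_atTop _
  have hev₅ : ∀ᶠ k : ℕ in atTop, B * Real.exp (-((3 / 16) * L k) + δ) ≤ 1 / 100 := by
    have h1 : Tendsto (fun k => -((3 / 16) * L k) + δ) atTop atBot :=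
      tendsto_atBot_add_const_right _ δ
        (tendsto_neg_atTop_atBot.comp (hL.const_mul_atTop (by norm_num : (0 : ℝ) < 3 / 16)))
    have h2 : Tendsto (fun k => B * Real.exp (-((3 / 16) * L k) + δ)) atTop (𝓝 (B * 0)) :=
      (Real.tendsto_exp_atBot.comp h1).const_mul B
    rw [mul_zero] at h2
    exact h2.eventually (ge_mem_nhds (by norm_num))
  have hev₆ : ∀ᶠ k : ℕ in atTop, 16 * δ ≤ L k := hL.eventually_ge_atTop _
  obtain ⟨K₀, hK₀⟩ :=
    eventually_atTop.1 (hev₁.and (hev₂.and (hev₃.and (hev₄.and (hev₅.and hev₆)))))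
  -- solve at stage k = j + K₀
  have hsol : ∀ j : ℕ, ∃ z : ℂ, exp (r.eval z) = q.eval (exp z) ∧
      z.re ≤ -((3 / 16) * L (j + K₀)) + δ ∧ L (j + K₀) / 3 - δ ≤ ‖z‖ ∧
      ‖z‖ ≤ 3 * L (j + K₀) + δ := by
    intro j
    obtain ⟨h1, h2, h3, h4, h5, h6⟩ := hK₀ (j + K₀) (Nat.le_add_left _ _)
    obtain ⟨z₀, hroot, hup, hlow, hre₀⟩ := exists_alRoot r hd ω s hs hω hre c₀ (j + K₀)
      (by push_cast at h1 ⊢; linarith)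
    have hLk : L (j + K₀) = (((j + K₀ : ℕ) : ℝ) + 1) * ‖ω‖ := rfl
    have hz1 : 1 ≤ ‖z₀‖ := by rw [hLk] at h2; linarith
    have haz : 1 ≤ ‖a‖ * ‖z₀‖ := by
      rw [hLk] at h3
      nlinarith [mul_le_mul_of_nonneg_left hlow hapos.le]
    have hEz : C₂ ≤ ‖z₀‖ := by rw [hLk] at h4; linarith
    have hre' : z₀.re + δ ≤ -((3 / 16) * L (j + K₀)) + δ := by rw [hLk]; linarith
    have hρ : B * Real.exp (z₀.re + 2 / (d * ‖a‖)) ≤ 1 / 100 := by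
      refine le_trans ?_ h5
      exact mul_le_mul_of_nonneg_left (Real.exp_le_exp.mpr hre')
        (div_nonneg (coeffNormSum_nonneg q) (norm_nonneg _))
    have hρ1 : Real.exp (z₀.re + 2 / (d * ‖a‖)) ≤ 1 := by
      rw [← Real.exp_zero]
      refine Real.exp_le_exp.mpr (hre'.trans ?_)
      have : 0 ≤ L (j + K₀) := by rw [hLk]; positivity
      linarith
    have hTexp : exp ((((j + K₀ + 1) ^ d * s : ℤ) : ℂ) * (2 * Real.pi * I)) = 1 :=
      Complex.exp_int_mul_two_pi_mul_I _
    obtain ⟨z, hz, hdist⟩ := exists_expPoint_near r q hd hq0 z₀ _ c₀ hroot hTexp hc₀ hz1 haz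
      hEz hρ hρ1
    refine ⟨z, hz, ?_, ?_, ?_⟩
    · have : z.re ≤ z₀.re + δ := by
        have h := re_le_norm (z - z₀)
        rw [Complex.sub_re] at h
        linarith
      exact this.trans hre'
    · have h := norm_sub_norm_le z₀ z
      rw [norm_sub_rev] at h
      rw [hLk]; linarith
    · have h := norm_le_insert' z z₀
      rw [hLk]; linarith
  choose z hz using hsol
  refine ⟨z, fun j => exp (z j), ?_, fun j => exp_ne_zero _, ?_, fun j => rfl, fun j => (hz j).1⟩
  · -- ‖z_j‖ → ∞
    refine tendsto_norm_atTop_of_le (hL.comp (tendsto_add_atTop_nat K₀)) (a := 1 / 3) (b := δ)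
      (by norm_num) fun j => ?_
    have := (hz j).2.2.1
    simp only [Function.comp_apply]
    linarith
  · -- super-polynomial decay with scale `K_j = (3/16) L_{j+K₀} - δ`
    intro N
    have hK : Tendsto (fun j => (3 / 16) * L (j + K₀) - δ) atTop atTop :=
      tendsto_atTop_add_const_right _ (-δ)
        ((hL.comp (tendsto_add_atTop_nat K₀)).const_mul_atTop (by norm_num : (0 : ℝ) < 3 / 16))
    refine superdecay_of_le hK (A := 32) (fun j => ?_) (fun j => ?_) N
    · obtain ⟨-, -, -, -, -, h6⟩ := hK₀ (j + K₀) (Nat.le_add_left _ _)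
      have := (hz j).2.2.2
      linarith
    · rw [Complex.norm_exp]
      refine Real.exp_le_exp.mpr ?_
      have := (hz j).2.1
      linarith

/-- **Degenerate escape + elimination for the aligned family**: given a root direction `ω`
(`a ω^d = 2πi s`, `s = ±1`, `Re ω ≤ -‖ω‖/2`), the exponential points of `A_{r,q}` are Zariski
dense (`deg r ≥ 2`, `q(0) ≠ 0`). (new in this file) [folklore] -/
theorem unprojectedDense_alignedSurface_of_dir (r q : Polynomial ℂ) (hd : 2 ≤ r.natDegree)
    (hq0 : q.eval 0 ≠ 0) (ω : ℂ) (s : ℤ) (hs : s = 1 ∨ s = -1)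
    (hω : r.leadingCoeff * ω ^ r.natDegree = 2 * Real.pi * I * s) (hre : ω.re ≤ -(‖ω‖ / 2)) :
    UnprojectedDense (alignedSurface r q) := by
  obtain ⟨z, w, hz, hw, hdec, h₁, h₂⟩ := exists_alignedSeq r q hd hq0 ω s hs hω hre
  exact unprojectedDense_alignedSurface_of_seq r q z w hz hw hdec h₁ h₂

end Supply

/-! ### Part 4 — root directions exist for `d ≥ 2`; the unconditional theorems -/

section Direction

/-- `e^{π m i} = ±1` for `m ∈ ℤ`. [folklore] -/
theorem exists_sign_exp_pi_mul_int (m : ℤ) :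
    ∃ s : ℤ, (s = 1 ∨ s = -1) ∧ exp ((Real.pi : ℂ) * m * I) = s := by
  obtain ⟨j, hj | hj⟩ := Int.even_or_odd' m
  · refine ⟨1, Or.inl rfl, ?_⟩
    rw [hj]
    have : (Real.pi : ℂ) * ((2 * j : ℤ) : ℂ) * I = (j : ℂ) * (2 * Real.pi * I) := by
      push_cast; ring
    rw [this, Complex.exp_int_mul_two_pi_mul_I]
    simp
  · refine ⟨-1, Or.inr rfl, ?_⟩
    rw [hj]
    have : (Real.pi : ℂ) * ((2 * j + 1 : ℤ) : ℂ) * I =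
        (j : ℂ) * (2 * Real.pi * I) + Real.pi * I := by
      push_cast; ring
    rw [this, Complex.exp_add, Complex.exp_int_mul_two_pi_mul_I, Complex.exp_pi_mul_I]
    simp

/-- `cos θ ≤ -1/2` on `[2π/3, 4π/3]`. [folklore] -/
theorem cos_le_neg_half {θ : ℝ} (h₁ : 2 * Real.pi / 3 ≤ θ) (h₂ : θ ≤ 4 * Real.pi / 3) :
    Real.cos θ ≤ -(1 / 2) := by
  have hφ : |θ - Real.pi| ≤ Real.pi / 3 := by
    rw [abs_le]; constructor <;> linarith
  have h1 : Real.cos (Real.pi / 3) ≤ Real.cos (|θ - Real.pi|) :=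
    Real.cos_le_cos_of_nonneg_of_le_pi (abs_nonneg _) (by linarith [Real.pi_pos]) hφ
  rw [Real.cos_abs, Real.cos_pi_div_three, Real.cos_sub_pi] at h1
  linarith

/-- **Root directions exist in degree `d ≥ 2`**: for `a ≠ 0` there are `ω` and `s = ±1` with
`a ω^d = 2πi s` and `Re ω ≤ -‖ω‖/2` (the admissible arguments `θ = (π/2 - arg a + πm)/d` are
`π/d ≤ π/2` apart, and `[2π/3, 4π/3]` has length `2π/3`). (new in this file) [folklore] -/
theorem exists_rootDirection (a : ℂ) (ha : a ≠ 0) (d : ℕ) (hd : 2 ≤ d) :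
    ∃ (ω : ℂ) (s : ℤ), (s = 1 ∨ s = -1) ∧ a * ω ^ d = 2 * Real.pi * I * s ∧
      ω.re ≤ -(‖ω‖ / 2) := by
  have hdpos : (0 : ℝ) < d := by exact_mod_cast (show 0 < d by omega)
  have hd2 : (2 : ℝ) ≤ d := by exact_mod_cast hd
  have hapos : 0 < ‖a‖ := norm_pos_iff.mpr ha
  set α : ℝ := Complex.arg a with hα
  -- the argument
  set m : ℤ := ⌈(d * (2 * Real.pi / 3) - (Real.pi / 2 - α)) / Real.pi⌉ with hm
  set θ : ℝ := (Real.pi / 2 - α + Real.pi * m) / d with hθ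
  have hdθ : (d : ℝ) * θ = Real.pi / 2 - α + Real.pi * m := by
    rw [hθ]; field_simp
  have hm1 := Int.le_ceil ((d * (2 * Real.pi / 3) - (Real.pi / 2 - α)) / Real.pi)
  have hm2 := Int.ceil_lt_add_one ((d * (2 * Real.pi / 3) - (Real.pi / 2 - α)) / Real.pi)
  rw [← hm] at hm1 hm2
  have hπ := Real.pi_pos
  have hθ1 : 2 * Real.pi / 3 ≤ θ := by
    rw [div_le_iff₀ hπ] at hm1
    rw [hθ, le_div_iff₀ hdpos]
    nlinarith
  have hθ2 : θ ≤ 4 * Real.pi / 3 := by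
    have hm2' : Real.pi * (m : ℝ) < d * (2 * Real.pi / 3) - (Real.pi / 2 - α) + Real.pi := by
      have := mul_lt_mul_of_pos_left hm2 hπ
      rwa [mul_add, mul_div_cancel₀ _ hπ.ne', mul_one] at this
    have h1 : (d : ℝ) * θ ≤ d * (2 * Real.pi / 3) + Real.pi := by rw [hdθ]; linarith
    -- θ ≤ 2π/3 + π/d ≤ 2π/3 + π/2
    have h2 : θ ≤ 2 * Real.pi / 3 + Real.pi / d := by
      rw [show 2 * Real.pi / 3 + Real.pi / d = (d * (2 * Real.pi / 3) + Real.pi) / d by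
        field_simp]
      rw [le_div_iff₀ hdpos]
      linarith
    have h3 : Real.pi / d ≤ Real.pi / 2 := div_le_div_of_nonneg_left hπ.le (by norm_num) hd2
    linarith
  -- the modulus
  set ρ : ℝ := (2 * Real.pi / ‖a‖) ^ ((d : ℝ)⁻¹) with hρ
  have hρpos : 0 < ρ := Real.rpow_pos_of_pos (by positivity) _
  have hρd : ρ ^ d = 2 * Real.pi / ‖a‖ :=
    Real.rpow_inv_natCast_pow (by positivity) (by omega)
  obtain ⟨s, hs, hsexp⟩ := exists_sign_exp_pi_mul_int m
  refine ⟨(ρ : ℂ) * exp ((θ : ℂ) * I), s, hs, ?_, ?_⟩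
  · -- `a ω^d = ‖a‖ ρ^d e^{i(α + dθ)} = 2π e^{i(π/2 + πm)} = 2πi s`
    have hexpd : exp ((θ : ℂ) * I) ^ d = exp (((d : ℝ) * θ : ℝ) * I) := by
      rw [← Complex.exp_nat_mul]; push_cast; ring_nf
    have ha' : a = (‖a‖ : ℂ) * exp ((α : ℂ) * I) := (Complex.norm_mul_exp_arg_mul_I a).symm
    rw [mul_pow, hexpd, hdθ, ha']
    have hρdC : ((ρ : ℂ)) ^ d = ((2 * Real.pi / ‖a‖ : ℝ) : ℂ) := by rw [← hρd]; push_cast; rfl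
    rw [hρdC]
    have hI : exp (((Real.pi / 2 : ℝ) : ℂ) * I) = I := by
      rw [Complex.exp_mul_I]
      push_cast
      rw [Complex.cos_pi_div_two, Complex.sin_pi_div_two]
      ring
    have hsplit : exp (((Real.pi / 2 - α + Real.pi * m : ℝ) : ℂ) * I) =
        exp (((Real.pi / 2 : ℝ) : ℂ) * I) * exp (-((α : ℂ) * I)) * exp ((Real.pi : ℂ) * m * I) := by
      rw [← Complex.exp_add, ← Complex.exp_add]
      congr 1; push_cast; ring
    rw [hsplit, hI, hsexp]
    have haC : (‖a‖ : ℂ) ≠ 0 := Complex.ofReal_ne_zero.mpr hapos.ne'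
    have hee : exp ((α : ℂ) * I) * exp (-((α : ℂ) * I)) = 1 := by
      rw [← Complex.exp_add, add_neg_cancel, Complex.exp_zero]
    push_cast
    field_simp
    linear_combination (s : ℂ) * hee
  · -- `Re ω = ρ cos θ ≤ -ρ/2 = -‖ω‖/2`
    have hre : ((ρ : ℂ) * exp ((θ : ℂ) * I)).re = ρ * Real.cos θ := by
      rw [Complex.re_ofReal_mul, Complex.exp_ofReal_mul_I_re]
    have hnorm : ‖(ρ : ℂ) * exp ((θ : ℂ) * I)‖ = ρ := by
      rw [norm_mul, Complex.norm_real, Complex.norm_exp_ofReal_mul_I, mul_one, Real.norm_eq_abs,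
        abs_of_pos hρpos]
    rw [hre, hnorm]
    have := cos_le_neg_half hθ1 hθ2
    nlinarith

end Direction

/-! ### Part 5 — the theorems: Mantova–Masser's question for `A_{r,q}`, `deg r ≥ 2`, `q(0) ≠ 0` -/

section Main

variable (r q : Polynomial ℂ)

/-- **Unprojected density for the aligned family, no coefficient condition**: for `deg r ≥ 2` and
`q(0) ≠ 0`, `I(A_{r,q} ∩ Γ_exp) = I(A_{r,q})`. (new in this file) [folklore] -/
theorem unprojectedDense_alignedSurface (hd : 2 ≤ r.natDegree) (hq0 : q.eval 0 ≠ 0) :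
    UnprojectedDense (alignedSurface r q) := by
  have ha : r.leadingCoeff ≠ 0 := by
    rw [Ne, Polynomial.leadingCoeff_eq_zero]
    rintro rfl
    simp at hd
  obtain ⟨ω, s, hs, hω, hre⟩ := exists_rootDirection r.leadingCoeff ha r.natDegree hd
  exact unprojectedDense_alignedSurface_of_dir r q hd hq0 ω s hs hω hre

/-- **Removing `q(0) ≠ 0`**: for `deg r ≥ 2` and any `q ≠ 0`, `I(A_{r,q} ∩ Γ_exp) = I(A_{r,q})`.
Write `q = X^m q₁` with `q₁(0) ≠ 0`; the escape sequence of `A_{r - mX, q₁}` (`e^{z} = w`,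
`e^{r(z) - mz} = q₁(w)`) satisfies `e^{r(z)} = w^m q₁(w) = q(w)`. (new in this file) [folklore] -/
theorem unprojectedDense_alignedSurface_of_ne_zero (hd : 2 ≤ r.natDegree) (hq : q ≠ 0) :
    UnprojectedDense (alignedSurface r q) := by
  obtain ⟨q₁, hq₁, hndvd⟩ := Polynomial.exists_eq_pow_rootMultiplicity_mul_and_not_dvd q hq 0
  set m : ℕ := q.rootMultiplicity 0 with hm
  have hq₁0 : q₁.eval 0 ≠ 0 := by
    intro h
    apply hndvd
    rw [Polynomial.dvd_iff_isRoot]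
    exact h
  set r' : Polynomial ℂ := r - Polynomial.C (m : ℂ) * Polynomial.X with hr'
  have hlt : (Polynomial.C (m : ℂ) * Polynomial.X).natDegree < r.natDegree :=
    lt_of_le_of_lt ((Polynomial.natDegree_C_mul_le _ _).trans Polynomial.natDegree_X_le)
      (lt_of_lt_of_le (by norm_num) hd)
  have hdeg : r'.natDegree = r.natDegree := Polynomial.natDegree_sub_eq_left_of_natDegree_lt hlt
  have hd' : 2 ≤ r'.natDegree := hdeg ▸ hd
  have ha' : r'.leadingCoeff ≠ 0 := by
    rw [Ne, Polynomial.leadingCoeff_eq_zero]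
    rintro h
    rw [h] at hd'
    simp at hd'
  obtain ⟨ω, s, hs, hω, hre⟩ := exists_rootDirection r'.leadingCoeff ha' r'.natDegree hd'
  obtain ⟨z, w, hz, hw, hdec, h₁, h₂⟩ := exists_alignedSeq r' q₁ hd' hq₁0 ω s hs hω hre
  refine unprojectedDense_alignedSurface_of_seq r q z w hz hw hdec h₁ fun j => ?_
  have hr : r.eval (z j) = r'.eval (z j) + (m : ℂ) * z j := by
    simp only [hr', Polynomial.eval_sub, Polynomial.eval_mul, Polynomial.eval_C,
      Polynomial.eval_X]
    ring
  rw [hr, Complex.exp_add, h₂ j, Complex.exp_nat_mul, h₁ j, hq₁]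
  simp only [Polynomial.eval_mul, Polynomial.eval_pow, Polynomial.eval_sub, Polynomial.eval_X,
    Polynomial.eval_C, sub_zero]
  ring

/-- **Mantova–Masser's density question decided for the whole aligned family**: for `deg r ≥ 2`
and `q ≠ 0`, `A_{r,q}` is in case (dim-pi-S-1-free) AND its exponential points are Zariski dense
— no condition on the coefficients. (new in this file) [folklore] -/
theorem unprojectedDensityQuestion_instance_aligned (hd : 2 ≤ r.natDegree) (hq : q ≠ 0) :
    MMCaseDimPiOneFree (alignedSurface r q) ∧ UnprojectedDense (alignedSurface r q) :=
  ⟨mmCase_alignedSurface_of_two_le r hd hq, unprojectedDense_alignedSurface_of_ne_zero r q hd hq⟩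

/-! #### Corollary: the CROSSED surfaces `S_{p, β + γ X}` with an affine fibre `y₀ = β + γ y₁`
(`γ ≠ 0`) are aligned surfaces — deciding the cases `x₁ = -x₀²`, `x₁ = x₀³` (fibre `y₀ + y₁ = 1`)
not covered by the leading-coefficient criterion of `EACDensityFamilies`. -/

/-- `S_{p, β + γX} = A_{p, (X - β)/γ}` (`γ ≠ 0`): `y₀ = β + γ y₁ ↔ y₁ = (y₀ - β)/γ`. [folklore] -/
theorem graphPolySurface_affine_eq_alignedSurface (p : Polynomial ℂ) (β γ : ℂ) (hγ : γ ≠ 0) :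
    graphPolySurface p (Polynomial.C β + Polynomial.C γ * Polynomial.X) =
      alignedSurface p (Polynomial.C γ⁻¹ * (Polynomial.X - Polynomial.C β)) := by
  ext z
  rw [mem_graphPolySurface_iff, mem_alignedSurface_iff]
  simp only [Polynomial.eval_add, Polynomial.eval_mul, Polynomial.eval_C, Polynomial.eval_X,
    Polynomial.eval_sub]
  constructor
  · rintro ⟨h1, h2⟩
    refine ⟨h1, ?_⟩
    rw [h2]; field_simp; ring
  · rintro ⟨h1, h2⟩
    refine ⟨h1, ?_⟩
    rw [h2]; field_simp; ring

/-- **The crossed surfaces with affine fibre are decided**: for `deg p ≥ 2`, `γ ≠ 0` and any `β`,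
`S_{p, β + γX} = {x₁ = p(x₀), y₀ = β + γ y₁}` is in case (dim-pi-S-1-free) with Zariski-dense
exponential points — for EVERY leading coefficient of `p`. (new in this file) [folklore] -/
theorem unprojectedDensityQuestion_instance_affineFibre (p : Polynomial ℂ) (hd : 2 ≤ p.natDegree)
    (β γ : ℂ) (hγ : γ ≠ 0) :
    MMCaseDimPiOneFree (graphPolySurface p (Polynomial.C β + Polynomial.C γ * Polynomial.X)) ∧
      UnprojectedDense (graphPolySurface p (Polynomial.C β + Polynomial.C γ * Polynomial.X)) := by
  rw [graphPolySurface_affine_eq_alignedSurface p β γ hγ]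
  refine unprojectedDensityQuestion_instance_aligned p _ hd ?_
  intro h
  have := congrArg (Polynomial.eval (β + 1)) h
  simp [hγ] at this

/-- **Example — `{x₁ = -x₀², y₀ + y₁ = 1}` (`e^{z} + e^{-z²} = 1`)**, NOT covered by the
leading-coefficient criterion (`Re(-1·(±i)²) = 1 > 0`), is decided: case (dim-pi-S-1-free) with
dense exponential points. [folklore] -/
example : MMCaseDimPiOneFree (graphPolySurface (-Polynomial.X ^ 2)
      (Polynomial.C 1 + Polynomial.C (-1) * Polynomial.X)) ∧
    UnprojectedDense (graphPolySurface (-Polynomial.X ^ 2)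
      (Polynomial.C 1 + Polynomial.C (-1) * Polynomial.X)) :=
  unprojectedDensityQuestion_instance_affineFibre _ (by simp) 1 (-1) (by norm_num)

/-- **Example — `{x₁ = x₀³, y₀ + y₁ = 1}` (`e^{z} + e^{z³} = 1`)** is decided likewise. [folklore] -/
example : MMCaseDimPiOneFree (graphPolySurface (Polynomial.X ^ 3)
      (Polynomial.C 1 + Polynomial.C (-1) * Polynomial.X)) ∧
    UnprojectedDense (graphPolySurface (Polynomial.X ^ 3)
      (Polynomial.C 1 + Polynomial.C (-1) * Polynomial.X)) :=
  unprojectedDensityQuestion_instance_affineFibre _ (by simp) 1 (-1) (by norm_num)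

/-- **Example — `A_{X², 2 - X} = {x₁ = x₀², y₁ = 2 - y₀}` (`e^{z²} + e^{z} = 2`)**. [folklore] -/
example : MMCaseDimPiOneFree (alignedSurface (Polynomial.X ^ 2) (Polynomial.C 2 - Polynomial.X)) ∧
    UnprojectedDense (alignedSurface (Polynomial.X ^ 2) (Polynomial.C 2 - Polynomial.X)) :=
  unprojectedDensityQuestion_instance_aligned _ _ (by simp) (by
    intro h
    have := congrArg (Polynomial.eval 0) h
    simp at this)

end Main

end Literature.ModelTheory.Zilber
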